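import Summits.CriticalPhenomena.PercolationContinuityZ3.Theorems.PercNearOneGluingNoHeavyQuantFarSunTKGenSym
import Summits.CriticalPhenomena.PercolationContinuityZ3.Theorems.PercNearOneGluingNoHeavyQuantFarSunTKFinal
import HarnessLib

/-!
# FAR beyond trees: `HairyCycle.SunFAR K j` at ANY layer `j` from a relay-set-level two-copy certificate — the generic final step

builds on p205010 (kernel theorem, internal audit signed; external expert review pending)

Support file (`--supports stmt-CriticalPhenomena-4575`), seat `prim-cert-1` (gen 25); memo `prim-cert-1/FROM-prim-cert-1-g25-*.md`.
Gen 23 proved `SunFAR K 1` for every `K` from the closed-form certificate `T_K` (`…TKFinal`) and, for `K = 3`, from a tabulated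
certificate checked against the CORE INEQUALITY of `…TKGenSym` (`…TKThree`).  This file records the final step once and for all, for an
ARBITRARY layer `j` and an ARBITRARY certificate of the relay-set-level shape
  `F(R;R') = Σ_{k<K} a_k(R')·(𝟙[k ∉ R] − 𝟙[|R| ≤ j]) − b(R')·(|R| − 2j)`,  `W(R,R') = F(R;R') + F(R';R)`:
* `TK.Fgen`, `TK.Wgen`, `TK.Wgen_comm`, `TK.two_mul_tcE2_Fgen` — the pair function, its symmetrisation, `2·E⊗E F = E⊗E W`;
* **`TK.sunFAR_of_layerCert`** — if `a, b ≥ 0`, every ghost outcome `R' ⊆ range K` with `|R'| ≤ j` bets (`Σ_k a_k(R') ≥ 1`), and `W`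
  satisfies the core inequality (nested pair + suffix swap, sure hairs `Z`, split hairs `T` — the hypothesis of `TK.tcE2_nonneg_of_core`),
  then `SunFAR K j` (`K ≥ 2`).  Proof: the law-level symmetrisation gives `E⊗E W ≥ 0`, the certificate identity turns `E⊗E F ≥ 0` into
  `Σ_k ā_k (P(k ∉ R) − P(N ≤ j)) ≥ b̄ (EN − 2j) ≥ 0`, and `Σ_k ā_k ≥ P(N ≤ j)` by the normalisation.
So every layer-`j` certificate (closed form or table) reduces `SunFAR K j` — hence the layer-`j` body of `Quant.FarRelayRow` on every hairy
cycle / ring with `K` relays (`HairyCycle.farRelayRow_hairyCycle_of_sunFAR`, gen 20) — to `a, b ≥ 0`, the normalisation, and the core inequality.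
No sorries; standard axioms.  Elementary [this work].
-/

noncomputable section

namespace Summit.CriticalPhenomena.PercolationContinuityZ3.Theorems.HairyCycle

namespace TK

open Finset

variable {K : ℕ}

/-- The layer-`j` relay-set-level pair function of a certificate `(a, b)`:
`F(R;R') = Σ_{k<K} a_k(R')·(𝟙[k ∉ R] − 𝟙[|R| ≤ j]) − b(R')·(|R| − 2j)`. [this work] -/
def Fgen (K j : ℕ) (a : ℕ → Finset ℕ → ℤ) (b : Finset ℕ → ℤ) (R R' : Finset ℕ) : ℤ :=
  (∑ k ∈ range K, a k R' * ((if k ∉ R then 1 else 0) - (if R.card ≤ j then 1 else 0))) - b R' * ((R.card : ℤ) - 2 * j)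

/-- The symmetrised pair weight `W(R,R') = F(R;R') + F(R';R)`. [this work] -/
def Wgen (K j : ℕ) (a : ℕ → Finset ℕ → ℤ) (b : Finset ℕ → ℤ) (R R' : Finset ℕ) : ℤ :=
  Fgen K j a b R R' + Fgen K j a b R' R

/-- `W` is symmetric. [this work] -/
theorem Wgen_comm (K j : ℕ) (a : ℕ → Finset ℕ → ℤ) (b : Finset ℕ → ℤ) (V U : Finset ℕ) :
    Wgen K j a b V U = Wgen K j a b U V := by
  unfold Wgen; ring

section Final

open scoped Classical

/-- `2 · E⊗E F = E⊗E W`. [this work] -/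
theorem two_mul_tcE2_Fgen (j : ℕ) (a : ℕ → Finset ℕ → ℤ) (b : Finset ℕ → ℤ) (g h : ℕ → ℝ) :
    2 * tcE2 K g h (fun R R' => (Fgen K j a b R R' : ℝ)) = tcE2 K g h (fun R R' => (Wgen K j a b R R' : ℝ)) := by
  have hsw := tcE2_swap (K := K) g h (fun R R' => (Fgen K j a b R R' : ℝ))
  have hlin := tcE2_lin (K := K) g h 1 1 (fun R R' => (Fgen K j a b R R' : ℝ)) (fun R R' => (Fgen K j a b R' R : ℝ))
  have hWdef : tcE2 K g h (fun R R' => (Wgen K j a b R R' : ℝ)) =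
      tcE2 K g h (fun R R' => 1 * (Fgen K j a b R R' : ℝ) + 1 * (Fgen K j a b R' R : ℝ)) := by
    congr 1; ext R R'; unfold Wgen; push_cast; ring
  rw [hWdef, hlin, hsw]
  ring

/-- **`SunFAR K j` from a layer-`j` two-copy certificate** (`K ≥ 2`).  Hypotheses: `a_k(R') ≥ 0` and `b(R') ≥ 0` on subsets of
`range K`; the normalisation `Σ_{k<K} a_k(R') ≥ 1` for every `R' ⊆ range K` with `|R'| ≤ j` (every small ghost outcome bets); and the
CORE INEQUALITY for `W = F + Fᵀ` (the hypothesis of `TK.tcE2_nonneg_of_core`).  Conclusion: FAR at layer `j` on the sun graph with `K`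
hairs, all weights. [this work] -/
theorem sunFAR_of_layerCert {j : ℕ} (hK : 2 ≤ K) {a : ℕ → Finset ℕ → ℤ} {b : Finset ℕ → ℤ}
    (ha : ∀ k, ∀ R', R' ⊆ range K → 0 ≤ a k R') (hb : ∀ R', R' ⊆ range K → 0 ≤ b R')
    (hnorm : ∀ R', R' ⊆ range K → R'.card ≤ j → (1 : ℤ) ≤ ∑ k ∈ range K, a k R')
    (hcore : ∀ l m u v : ℕ, m ≤ l → l ≤ K + 1 → u ≤ v → v ≤ K →
      ∀ Z T : Finset ℕ, Z ⊆ range K → T ⊆ range K → Disjoint Z T →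
        0 ≤ (∑ J ∈ T.powerset, Wgen K j a b (cov K l u ∩ (Z ∪ J)) (cov K m v ∩ (Z ∪ (T \ J)))) +
          ∑ J ∈ T.powerset, Wgen K j a b (cov K l v ∩ (Z ∪ J)) (cov K m u ∩ (Z ∪ (T \ J)))) :
    SunFAR K j := by
  intro g h hg hh hEN t ht
  set P1 : ℝ := sunLaw K g h (fun R => R.card ≤ j) with hP1
  have eP1 : P1 = tcE K g h (fun R => if R.card ≤ j then 1 else 0) := by
    rw [hP1, sunLaw_eq_tcE]; exact tcE_congr fun R _ => by congr
  have eq_k : ∀ k, k < K → tcE K g h (fun R => if k ∉ R then (1 : ℝ) else 0) = 1 - sunMarg K g h k := by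
    intro k hk
    rw [← sunLaw_mem_eq_sunMarg hK hg hh hk, ← sunLaw_not hK hg hh, sunLaw_eq_tcE]
    exact tcE_congr fun R _ => by congr
  have eEN : tcE K g h (fun R => (R.card : ℝ)) = ∑ k ∈ range K, sunMarg K g h k := by
    have e1 : tcE K g h (fun R => (R.card : ℝ)) = tcE K g h (fun R => ∑ k ∈ range K, if k ∈ R then (1 : ℝ) else 0) := by
      refine tcE_congr fun R hR => ?_
      rw [Finset.sum_ite_mem, Finset.inter_eq_right.2 hR, Finset.sum_const, nsmul_eq_mul, mul_one]
    rw [e1, tcE_sum]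
    refine Finset.sum_congr rfl fun k hk => ?_
    rw [Finset.mem_range] at hk
    rw [← sunLaw_mem_eq_sunMarg hK hg hh hk, sunLaw_eq_tcE]
    exact tcE_congr fun R _ => by congr
  -- the certificate identity
  set abar : ℕ → ℝ := fun k => tcE K g h (fun R' => (a k R' : ℝ)) with habar
  set bbar : ℝ := tcE K g h (fun R' => (b R' : ℝ)) with hbbar
  have hF : tcE2 K g h (fun R R' => (Fgen K j a b R R' : ℝ)) =
      ∑ k ∈ range K, (tcE K g h (fun R => if k ∉ R then (1 : ℝ) else 0) - P1) * abar k -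
        (tcE K g h (fun R => (R.card : ℝ)) - 2 * j) * bbar := by
    have epoint : (fun R R' => (Fgen K j a b R R' : ℝ)) = fun R R' =>
        1 * (∑ k ∈ range K, (a k R' : ℝ) * ((if k ∉ R then (1 : ℝ) else 0) - (if R.card ≤ j then (1 : ℝ) else 0))) +
          (-1) * ((b R' : ℝ) * ((R.card : ℝ) - 2 * j)) := by
      ext R R'; unfold Fgen; push_cast; ring
    have eA : ∀ k, tcE2 K g h (fun R R' => (a k R' : ℝ) * ((if k ∉ R then (1 : ℝ) else 0) - (if R.card ≤ j then (1 : ℝ) else 0))) =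
        (tcE K g h (fun R => if k ∉ R then (1 : ℝ) else 0) - P1) * abar k := by
      intro k
      have e1 : (fun R R' : Finset ℕ => (a k R' : ℝ) * ((if k ∉ R then (1 : ℝ) else 0) - (if R.card ≤ j then (1 : ℝ) else 0))) =
          fun R R' => (1 * (if k ∉ R then (1 : ℝ) else 0) + (-1) * (if R.card ≤ j then (1 : ℝ) else 0)) * (a k R' : ℝ) := by
        ext R R'; ring
      rw [e1, tcE2_prod, tcE_lin, ← eP1]; ring
    have eB : tcE2 K g h (fun R R' => (b R' : ℝ) * ((R.card : ℝ) - 2 * j)) = (tcE K g h (fun R => (R.card : ℝ)) - 2 * j) * bbar := by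
      have e1 : (fun R R' : Finset ℕ => (b R' : ℝ) * ((R.card : ℝ) - 2 * j)) =
          fun R R' => (1 * (R.card : ℝ) + (-(2 * j : ℝ)) * (1 : ℝ)) * (b R' : ℝ) := by
        ext R R'; ring
      rw [e1, tcE2_prod, tcE_lin, tcE_const]; ring
    rw [epoint, tcE2_lin, tcE2_sum, eB]
    simp only [eA]
    ring
  -- signs
  have habar0 : ∀ k, 0 ≤ abar k := fun k => tcE_nonneg hg hh fun R' hR' => by exact_mod_cast ha k R' hR'
  have hbbar0 : 0 ≤ bbar := tcE_nonneg hg hh fun R' hR' => by exact_mod_cast hb R' hR'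
  have hq : ∀ k ∈ range K, tcE K g h (fun R => if k ∉ R then (1 : ℝ) else 0) ≤ t := by
    intro k hk; rw [Finset.mem_range] at hk; rw [eq_k k hk]; exact ht k hk
  -- main inequality: Σ_k (q_k − P1)·ā_k ≥ (EN − 2j)·b̄ ≥ 0
  have hmain : 0 ≤ ∑ k ∈ range K, (tcE K g h (fun R => if k ∉ R then (1 : ℝ) else 0) - P1) * abar k := by
    have h1 : 0 ≤ tcE2 K g h (fun R R' => (Fgen K j a b R R' : ℝ)) := by
      have hW := tcE2_nonneg_of_core hcore (Wgen_comm K j a b) hg hh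
      have h2 := two_mul_tcE2_Fgen (K := K) j a b g h
      linarith
    rw [hF, eEN] at h1
    have h2 : 0 ≤ (∑ k ∈ range K, sunMarg K g h k - 2 * j) * bbar := mul_nonneg (by linarith) hbbar0
    linarith
  have hsum : 0 ≤ ∑ k ∈ range K, (t - P1) * abar k := by
    refine le_trans hmain (Finset.sum_le_sum fun k hk => ?_)
    exact mul_le_mul_of_nonneg_right (by linarith [hq k hk]) (habar0 k)
  rw [← Finset.mul_sum] at hsum
  -- `Σ_k ā_k ≥ P1` (every ghost outcome with at most `j` relays bets)
  have hge : P1 ≤ ∑ k ∈ range K, abar k := by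
    have e : ∑ k ∈ range K, abar k = tcE K g h (fun R' => ∑ k ∈ range K, (a k R' : ℝ)) := by rw [tcE_sum]
    rw [e, eP1]
    refine tcE_mono hg hh fun R' hR' => ?_
    split_ifs with hc
    · exact_mod_cast hnorm R' hR' hc
    · exact Finset.sum_nonneg fun k _ => by exact_mod_cast ha k R' hR'
  -- `t ≥ 0`
  have ht0 : 0 ≤ t := by
    have h0 : 0 < K := by omega
    have := ht 0 h0
    have hm : sunMarg K g h 0 ≤ 1 := by rw [← sunLaw_mem_eq_sunMarg hK hg hh h0]; exact sunLaw_le_one hK hg hh _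
    linarith
  refine le_of_not_gt fun hcon => ?_
  have hP1pos : 0 < P1 := lt_of_le_of_lt ht0 hcon
  have hpos : 0 < ∑ k ∈ range K, abar k := lt_of_lt_of_le hP1pos hge
  have : (t - P1) * ∑ k ∈ range K, abar k < 0 := mul_neg_of_neg_of_pos (by linarith) hpos
  linarith

end Final

end TK

end Summit.CriticalPhenomena.PercolationContinuityZ3.Theorems.HairyCycle

end
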